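import Summits.ResolutionOfSingularities.ResolutionOfSingularities.Theorems.PurelyInseparableDim4WinCertLeafSoundF4
import Summits.ResolutionOfSingularities.ResolutionOfSingularities.Theorems.PurelyInseparableDim4StepKitF8
import HarnessLib

/-!
# FCert v3, 𝔽₈ EDITION: a certificate with coefficients in `StepKit.F8` decides the ∀K column for its `𝔽₂`-rational rows over
# EVERY field of characteristic 2 (cell `res-dim4-pi`, ∀K column)

[OURS · counted 0 · a certificate format for OUR frame v4, not about resolution] Seat res-dim4-p-8 g4; the `𝔽₈` twin of
`…WinCertLeafSoundF4` (p689628).  Need: roots of the (2,2) band whose 2-fold locus on an exceptional chart consists of coordinate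
flats at `𝔽₈`-POINTS (e.g. `S1a-8d9e2ab78b = x₄³ + x₃x₄² + x₃³`: after blowing up `V(z, x₃, x₄)` the locus is `x₄³ + x₄² + 1 = 0`),
hence certificates over `F8 = 𝔽₂[t]/(t³ + t + 1)` checked by res-rescue-typ-3 g9's `lwinCertBL 8 2 leafOK` (cover witnesses
`x_i⁸ − x_i`) with the field-generic oracle `leafOKG` (p-8 g4).

* `exists_root_cubic` — an algebraically closed field has a root of `X³ + X + 1`;
* **`forall_inScopeStateWins_of_lwinCertBL_F8`** — for ANY sound oracle over `F8` and `T : LCert F8 C` with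
  `lwinCertBL 8 2 leafOK T = true`, every row whose presented state is `s₀.castF8` (`s₀` over `𝔽₂`) is IN-SCOPE ESCAPABLE over
  EVERY field `K` of characteristic `2`: read the certificate in `AlgebraicClosure K` along `StepKit.F8.lift β` (`β³ + β + 1 = 0`),
  identify `s₀ ⊗ K̄ = (s₀ ⊗ K) ⊗ K̄` (`StepKit.SData.map_castHom_eq_map_lift_castF8`) and DESCEND with res-dim4-p-14's
  `ScopeSymmetry.inScopeStateWins_of_inScopeStateWins_map`; `_leafOKG` specialisation; `_lift` form (∀ `K ∋ β`).
Data files read: `theorem … : lwinCertBL 8 2 (leafOKG 2) T = true := by decide` (rows over `StepKit.F8`, root row `s₀.castF8`),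
`forall_inScopeStateWins_of_lwinCertBL_F8_leafOKG … ⟨row, hrow, rfl⟩ K`.
Nothing here proves resolution of singularities in dimension ≥ 4 / characteristic `p`; F4-C(2,2) stays OPEN; the column this
feeds certifies `InScopeStateWins` on listed roots only.  Counted 0; AI work, weaker than expert review.
bears_on: LADDER-RESOLUTION:D157-DOOR2 (res-dim4-pi · F4-C ∀K column · FCert v3, 𝔽₈ edition).
Supports stmt-ResolutionOfSingularities-16155 (helper).
-/

set_option linter.dupNamespace false -- mandated namespace of this single-conjunct summit

noncomputable section
open MvPolynomial Finset
open scoped BigOperators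
namespace Summit.ResolutionOfSingularities.ResolutionOfSingularities.Theorems.PIDim4

namespace WinCertLeaf

open Literature.AlgebraicGeometry.Resolution
open Literature.AlgebraicGeometry.Resolution.CentreBlowup
open StepKit WinCertSound InScopeWinCert ScopeCover ScopeBlind WinCertAllFields WinCertFlat WinCertSubst

/-- an algebraically closed field contains a root of `X³ + X + 1`. [folklore] -/
theorem exists_root_cubic (K' : Type) [Field K'] [IsAlgClosed K'] : ∃ β : K', β ^ 3 + β + 1 = 0 := by
  obtain ⟨x, hx⟩ := IsAlgClosed.exists_root
    (Polynomial.C 1 * Polynomial.X ^ 3 + Polynomial.C 0 * Polynomial.X ^ 2 + Polynomial.C 1 * Polynomial.X + Polynomial.C 1 :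
      Polynomial K')
    (by rw [Polynomial.degree_cubic one_ne_zero]; decide)
  exact ⟨x, by simpa using hx⟩

/-- **𝔽₈ CERTIFICATES OVER EVERY FIELD OF CHARACTERISTIC 2.**  Let `leafOK` be a sound leaf oracle over `F8` and `T : LCert F8 C`
pass `lwinCertBL 8 2 leafOK` (cover witnesses `x_i⁸ − x_i`).  Then every row whose presented state is the `F8`-cast of an `𝔽₂`-state
`s₀` is IN-SCOPE ESCAPABLE over EVERY field `K` of characteristic `2` (player B ranging over all of `K⁴`): certificate read in
`K̄ = AlgebraicClosure K` along `F8.lift β`, then descent `K̄ ↝ K`. OURS. [folklore] -/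
theorem forall_inScopeStateWins_of_lwinCertBL_F8 {C : Type} {leafOK : SData 4 F8 → Finset (Fin 4) → ILeaf F8 C → Bool}
    (hs : LeafSoundF F8 2 leafOK) {T : LCert F8 C} (h : lwinCertBL 8 2 leafOK T = true) {s₀ : SData 4 (ZMod 2)}
    (hrow : ∃ row ∈ T, row.1.1 = s₀.castF8) (K : Type) [Field K] [CharP K 2] [DecidableEq K] :
    InScopeStateWins 2
      (⟨MvPolynomial.map (ZMod.castHom (dvd_refl 2) K) s₀.toState.F, s₀.toState.r, s₀.toState.exc⟩ : State K) := by
  classical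
  let Kb : Type := AlgebraicClosure K
  let g : K →+* Kb := algebraMap K Kb
  obtain ⟨β, hβ⟩ := exists_root_cubic Kb
  obtain ⟨row, hrowT, hrow0⟩ := hrow
  have hw := forall_inScopeStateWins_of_lwinCertBLF F8.card_F8 hs h Kb (F8.lift β hβ) row hrowT
  rw [hrow0, ← SData.map_castHom_eq_map_lift_castF8 s₀ β hβ, SData.castF8_toState_r, SData.castF8_toState_exc] at hw
  refine ScopeSymmetry.inScopeStateWins_of_inScopeStateWins_map g 2 ?_
  have e3 : MvPolynomial.map g (MvPolynomial.map (ZMod.castHom (dvd_refl 2) K) s₀.toState.F) =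
      MvPolynomial.map (ZMod.castHom (dvd_refl 2) Kb) s₀.toState.F := by
    rw [MvPolynomial.map_map, show g.comp (ZMod.castHom (dvd_refl 2) K) = ZMod.castHom (dvd_refl 2) Kb from Subsingleton.elim _ _]
  show InScopeStateWins 2
    (⟨MvPolynomial.map g (MvPolynomial.map (ZMod.castHom (dvd_refl 2) K) s₀.toState.F), s₀.toState.r, s₀.toState.exc⟩ : State Kb)
  rw [e3]
  exact hw

/-- **… with the generic oracle**: `lwinCertBL 8 2 (leafOKG 2) T = true` (one `decide` over `StepKit.F8`) ⟹ every `𝔽₂`-rational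
row is in-scope escapable over every field of characteristic `2`. OURS. [folklore] -/
theorem forall_inScopeStateWins_of_lwinCertBL_F8_leafOKG {T : LCert F8 (LeafCert4 F8)} (h : lwinCertBL 8 2 (leafOKG 2) T = true)
    {s₀ : SData 4 (ZMod 2)} (hrow : ∃ row ∈ T, row.1.1 = s₀.castF8) (K : Type) [Field K] [CharP K 2] [DecidableEq K] :
    InScopeStateWins 2
      (⟨MvPolynomial.map (ZMod.castHom (dvd_refl 2) K) s₀.toState.F, s₀.toState.r, s₀.toState.exc⟩ : State K) :=
  forall_inScopeStateWins_of_lwinCertBL_F8 (leafSoundG (k := F8) 2) h hrow K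

/-- **… and for rows over `F8` themselves, over every field CONTAINING a root of `X³ + X + 1`**, along `F8.lift β`. OURS.
[folklore] -/
theorem forall_inScopeStateWins_of_lwinCertBL_F8_lift {C : Type} {leafOK : SData 4 F8 → Finset (Fin 4) → ILeaf F8 C → Bool}
    (hs : LeafSoundF F8 2 leafOK) {T : LCert F8 C} (h : lwinCertBL 8 2 leafOK T = true) (K : Type) [Field K] [CharP K 2]
    [DecidableEq K] (β : K) (hβ : β ^ 3 + β + 1 = 0) :
    ∀ row ∈ T, InScopeStateWins 2
      (⟨MvPolynomial.map (F8.lift β hβ) row.1.1.toState.F, row.1.1.toState.r, row.1.1.toState.exc⟩ : State K) :=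
  forall_inScopeStateWins_of_lwinCertBLF F8.card_F8 hs h K (F8.lift β hβ)

end WinCertLeaf

end Summit.ResolutionOfSingularities.ResolutionOfSingularities.Theorems.PIDim4

end
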